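import Literature.Topology.FourManifolds.MMSWTwistedPictureImmersion
import HarnessLib

/-!
# Double points of the picture of a strip-twisted model knot (generic bands)

Sibling of `MMSWTwistedPictureImmersion.lean`, second step of "the twisted pictures
`D(0⃗)(stripTwistAt_k ∘ K)` are in general position" towards the named fact
`Literature.Topology.FourManifolds.MMSW.eventually_approxHasRasmussen` (Manolescu–Marengon–
Sarkar–Willis, arXiv:1910.08195, Thm. 1.4 / Prop. 8.2 (i); §8.1 in the tree's picture).

In the annular picture the offset strip twist rotates every point of an UPPER passage
(`Im z > 0`) through the band `|Re z - c_j - e_j| < w` by the angle `-arg stripUnit`, a function of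
`Re z` alone, and fixes everything else (`MMSWTwistedPicture`).  Hence, when the crossing values
of the original diagram avoid the (closed) band windows (`MMSWBandGenericity.exists_generic_bands`),
**a double point of the twisted diagram is either an old double point, at a radius outside all
windows, or a NEW one: an upper and a lower passage of the same band at the same radius**
(`twisted_doublePoint_dichotomy`); two upper (or two lower) points of a band at the same radius
are never identified (they would be an old crossing inside the window).  For the new double
points the equation is `c(s) · conj (stripUnit k w (z(s) - c_j - e_j)) = c(t)`
(`chartC_eq_of_twisted_doublePoint`), the input of the counting argument
(`SmoothTransitionFlatEnds.smoothTransition_fastPhase`).  Everything is proved; no definitions,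
no named facts.

## References

* C. Manolescu, M. Marengon, S. Sarkar, M. Willis, Duke Math. J. 172 (2023), arXiv:1910.08195,
  §2.1 and §8.1. [ManolescuMarengonSarkarWillis2023]
-/

open scoped Manifold ContDiff Topology ComplexConjugate
open Function Set Filter Complex

noncomputable section

namespace Literature.Topology.FourManifolds

/-- Local notation: `𝔼 n` is the model Euclidean space `EuclideanSpace ℝ (Fin n)`. -/
local notation "𝔼 " n:arg => EuclideanSpace ℝ (Fin n)

/-- Local notation: `𝕊 n` is the unit sphere in `EuclideanSpace ℝ (Fin (n + 1))`. -/
local notation "𝕊 " n:arg => (Metric.sphere (0 : EuclideanSpace ℝ (Fin (n + 1))) 1)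

namespace MMSW

open Literature.AlgebraicTopology.Homotopy.HopfFibration (zC wC ofZW zC_ofZW wC_ofZW ofZW_zC_wC)

variable {r : ℕ}

/-! ## The strip multiplier on a band -/

/-- A point of `M_r` whose `Re z` lies in the open window of band `j` is off the real axis
(else it would be inside hole `j`). [folklore] -/
theorem im_ne_zero_of_re_mem_window {z : ℂ} {j : Fin r} (hz : (1 : ℝ) ≤ ‖z - holeCentre r j‖)
    {e w : ℝ} (hew : |e| + w < 1) (hre : |z.re - (holeCentre r j).re - e| < w) : z.im ≠ 0 := by
  intro him
  have h1 : ‖z - holeCentre r j‖ = |z.re - (holeCentre r j).re| := by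
    have hz' : z - holeCentre r j = ((z.re - (holeCentre r j).re : ℝ) : ℂ) := by
      apply Complex.ext <;> simp [holeCentre, him]
    rw [hz', Complex.norm_real, Real.norm_eq_abs]
  have h2 : |z.re - (holeCentre r j).re| ≤ |z.re - (holeCentre r j).re - e| + |e| := by
    have := abs_add_le (z.re - (holeCentre r j).re - e) e
    simpa using this
  linarith

/-- The windows of different bands are far apart: a point in the open window of band `j` is off
band `j' ≠ j`. [folklore] -/
theorem le_abs_re_sub_of_ne {z : ℂ} {j j' : Fin r} (hjj' : j' ≠ j) {e : Fin r → ℝ} {w : ℝ}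
    (he : ∀ i, |e i| + w < 1) (hw : 0 < w) (hre : |z.re - (holeCentre r j).re - e j| < w) :
    w ≤ |z.re - (holeCentre r j').re - e j'| := by
  have h4 : (4 : ℝ) ≤ |(holeCentre r j).re - (holeCentre r j').re| := by
    have hne : (j : ℕ) ≠ (j' : ℕ) := fun h ↦ hjj' (Fin.ext h).symm
    simp only [holeCentre, Complex.ofReal_re]
    rcases Nat.lt_or_gt_of_ne hne with h | h
    · have : ((j : ℕ) : ℝ) + 1 ≤ ((j' : ℕ) : ℝ) := by exact_mod_cast h
      rw [abs_of_nonpos (by linarith)]; linarith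
    · have : ((j' : ℕ) : ℝ) + 1 ≤ ((j : ℕ) : ℝ) := by exact_mod_cast h
      rw [abs_of_nonneg (by linarith)]; linarith
  have hej := he j
  have hej' := he j'
  have h0 : 0 ≤ |e j| := abs_nonneg _
  -- `|x - c' - e'| ≥ |c - c'| - |x - c - e| - |e| - |e'| > 4 - w - 2 ≥ w`
  have key : |(holeCentre r j).re - (holeCentre r j').re| ≤
      |z.re - (holeCentre r j').re - e j'| + |z.re - (holeCentre r j).re - e j| + |e j| + |e j'| := by
    have h := abs_sub_le ((holeCentre r j).re) (z.re - e j) ((holeCentre r j').re)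
    have h1 : |(holeCentre r j).re - (z.re - e j)| = |z.re - (holeCentre r j).re - e j| := by
      rw [← abs_neg]; ring_nf
    have h2 : |z.re - e j - (holeCentre r j').re| ≤ |z.re - (holeCentre r j').re - e j'| + |e j'| + |e j| := by
      have h3 := abs_add_le (z.re - (holeCentre r j').re - e j') (e j' - e j)
      have h4 := abs_sub (e j') (e j)
      have : z.re - (holeCentre r j').re - e j' + (e j' - e j) = z.re - e j - (holeCentre r j').re := by
        ring
      rw [this] at h3
      linarith
    linarith
  have hw1 : w < 1 := by linarith
  linarith

/-- **On an upper point of the window of band `j` the offset strip multiplier is the `j`-th strip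
unit.** [folklore] -/
theorem stripMultiplierAt_eq_stripUnit {z : ℂ} {j : Fin r} {e : Fin r → ℝ} {w : ℝ} {k : ℤ}
    (he : ∀ i, |e i| + w < 1) (hw : 0 < w) (hre : |z.re - (holeCentre r j).re - e j| < w) :
    stripMultiplierAt r k w e z = stripUnit k w (z - holeCentre r j - e j) := by
  rw [stripMultiplierAt, Finset.prod_eq_single j]
  · intro j' _ hj'
    refine stripUnit_eq_one hw (Or.inr ?_)
    simpa using le_abs_re_sub_of_ne hj' he hw hre
  · intro h; exact absurd (Finset.mem_univ j) h

/-- The strip unit depends only on `Re ζ` on the open upper half-plane. [folklore] -/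
theorem stripUnit_eq_of_re_eq {ζ₁ ζ₂ : ℂ} (hre : ζ₁.re = ζ₂.re) (h₁ : 0 < ζ₁.im) (h₂ : 0 < ζ₂.im)
    (k : ℤ) (w : ℝ) : stripUnit k w ζ₁ = stripUnit k w ζ₂ := by
  simp [stripUnit, stripPhase, h₁, h₂, hre]

/-- **Two upper points with the same `Re z` have the same offset strip multiplier.** [folklore] -/
theorem stripMultiplierAt_eq_of_re_eq {z₁ z₂ : ℂ} (hre : z₁.re = z₂.re) (h₁ : 0 < z₁.im)
    (h₂ : 0 < z₂.im) (k : ℤ) (w : ℝ) (e : Fin r → ℝ) :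
    stripMultiplierAt r k w e z₁ = stripMultiplierAt r k w e z₂ := by
  unfold stripMultiplierAt
  refine Finset.prod_congr rfl fun j _ ↦ stripUnit_eq_of_re_eq ?_ ?_ ?_ k w
  · simp [hre]
  · simpa [holeCentre] using h₁
  · simpa [holeCentre] using h₂

/-! ## The planar coordinate of a picture knot and double points -/

/-- Equal plane-curve points have equal complex planar coordinates. [folklore] -/
theorem chartC_stereoCurve_eq_of_planeCurve_eq {K₃ : Knot} {s t : ℝ}
    (h : K₃.planeCurve s = K₃.planeCurve t) :
    chartC (K₃.stereoCurve s) = chartC (K₃.stereoCurve t) := by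
  rw [Knot.planeCurve_eq_fst_comp, comp_apply, comp_apply] at h
  apply Complex.ext
  · rw [chartC_re, chartC_re, h]
  · rw [chartC_im, chartC_im, h]

/-- **A double point of the twisted picture has equal radii `Re z`.** [folklore] -/
theorem re_zC_eq_of_twisted_doublePoint {K : 𝕊 1 → 𝔼 4} (hK : IsModelKnot r K)
    (hwK : ∀ t, wC (K t) ≠ 0) {K₃k : Knot} {k : ℤ} {w : ℝ} (hw : 0 < w) {e : Fin r → ℝ}
    (he : ∀ j, |e j| + w < 1) (hK₃k : ⇑K₃k = finiteApprox r 0 (stripTwistAt r k w e ∘ K))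
    {s t : ℝ} (hst : K₃k.planeCurve s = K₃k.planeCurve t) :
    (zC (K (circlePoint s))).re = (zC (K (circlePoint t))).re := by
  have hKk : IsModelKnot r (stripTwistAt r k w e ∘ K) := hK.stripTwistAt_comp k hw he
  have hwk : ∀ t, wC ((stripTwistAt r k w e ∘ K) t) ≠ 0 := fun t ↦
    wC_stripTwistAt_ne_zero k w e (hwK t)
  have hs := norm_chartC_stereoCurve hKk hwk hK₃k s
  have ht := norm_chartC_stereoCurve hKk hwk hK₃k t
  rw [chartC_stereoCurve_eq_of_planeCurve_eq hst, ht, comp_apply, comp_apply, zC_stripTwistAt,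
    zC_stripTwistAt] at hs
  linarith

/-- Off the open windows the offset strip twist does not move the point of the knot, so the
twisted picture agrees with the original one there. [folklore] -/
theorem planeCurve_twisted_eq_of_notMem_windows {K : 𝕊 1 → 𝔼 4} {K₃ K₃k : Knot}
    (hK₃ : ⇑K₃ = finiteApprox r 0 K) {k : ℤ} {w : ℝ} (hw : 0 < w) {e : Fin r → ℝ}
    (hK₃k : ⇑K₃k = finiteApprox r 0 (stripTwistAt r k w e ∘ K)) {s : ℝ}
    (hs : ∀ j : Fin r, (zC (K (circlePoint s))).re ∉
      Ioo ((holeCentre r j).re + e j - w) ((holeCentre r j).re + e j + w)) :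
    K₃k.planeCurve s = K₃.planeCurve s := by
  refine planeCurve_twisted_eq_of_apply_eq_one (φ := stripMultiplierAt r k w e) hK₃ hK₃k ?_
  refine stripMultiplierAt_eq_one hw fun j ↦ Or.inr ?_
  have h := hs j
  rw [mem_Ioo, not_and_or, not_lt, not_lt] at h
  rcases h with h | h
  · rw [le_abs]; right; linarith
  · rw [le_abs]; left; linarith

/-- **Dichotomy for the double points of the twisted picture.**  Assume the crossing values of
`D(0⃗)(K)` avoid the closed band windows.  If two parameters `s ≢ t (mod 2π)` have the same
twisted plane-curve point then either it is an OLD double point (and `Re z` is outside all closed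
windows at both), or `Re z(s) = Re z(t)` lies in the open window of some band `j` and exactly one
of the two points is upper (`Im z > 0`) and the other lower (`Im z < 0`). [cite: ManolescuMarengonSarkarWillis2023, §8.1] -/
theorem twisted_doublePoint_dichotomy {K : 𝕊 1 → 𝔼 4} (hK : IsModelKnot r K)
    (hwK : ∀ t, wC (K t) ≠ 0) {K₃ K₃k : Knot} (hK₃ : ⇑K₃ = finiteApprox r 0 K) {k : ℤ} {w : ℝ}
    (hw : 0 < w) {e : Fin r → ℝ} (he : ∀ j, |e j| + w < 1)
    (hK₃k : ⇑K₃k = finiteApprox r 0 (stripTwistAt r k w e ∘ K))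
    (hcross : ∀ s t, K₃.planeCurve s = K₃.planeCurve t → circlePoint s ≠ circlePoint t →
      ∀ j : Fin r, (zC (K (circlePoint s))).re ∉
        Icc ((holeCentre r j).re + e j - w) ((holeCentre r j).re + e j + w))
    {s t : ℝ} (hst : K₃k.planeCurve s = K₃k.planeCurve t) (hne : circlePoint s ≠ circlePoint t) :
    (K₃.planeCurve s = K₃.planeCurve t ∧ ∀ j : Fin r,
        (zC (K (circlePoint s))).re ∉ Icc ((holeCentre r j).re + e j - w) ((holeCentre r j).re + e j + w) ∧
        (zC (K (circlePoint t))).re ∉ Icc ((holeCentre r j).re + e j - w) ((holeCentre r j).re + e j + w)) ∨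
    (∃ j : Fin r, (zC (K (circlePoint s))).re ∈
        Ioo ((holeCentre r j).re + e j - w) ((holeCentre r j).re + e j + w) ∧
      (zC (K (circlePoint t))).re = (zC (K (circlePoint s))).re ∧
      ((0 < (zC (K (circlePoint s))).im ∧ (zC (K (circlePoint t))).im < 0) ∨
        ((zC (K (circlePoint s))).im < 0 ∧ 0 < (zC (K (circlePoint t))).im))) := by
  set zs := zC (K (circlePoint s)) with hzs
  set zt := zC (K (circlePoint t)) with hzt
  have hrad : zs.re = zt.re := re_zC_eq_of_twisted_doublePoint hK hwK hw he hK₃k hst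
  have h1 : ∀ t, ‖stripMultiplierAt r k w e (zC (K t))‖ = 1 := fun t ↦ norm_stripMultiplierAt _ _ _ _
  -- the twisted planar coordinates: `c_k = c · conj φ(z)`
  have hcs := chartC_stereoCurve_twisted (φ := stripMultiplierAt r k w e) hK₃ hK₃k h1 s
  have hct := chartC_stereoCurve_twisted (φ := stripMultiplierAt r k w e) hK₃ hK₃k h1 t
  have hck : chartC (K₃k.stereoCurve s) = chartC (K₃k.stereoCurve t) :=
    chartC_stereoCurve_eq_of_planeCurve_eq hst
  -- if the multipliers agree, it is an old double point
  have hold : stripMultiplierAt r k w e zs = stripMultiplierAt r k w e zt →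
      K₃.planeCurve s = K₃.planeCurve t := by
    intro hφ
    refine planeCurve_eq_of_chartC_eq ?_
    have hne0 : conj (stripMultiplierAt r k w e zt) ≠ 0 := by
      rw [map_ne_zero]; exact norm_ne_zero_iff.1 (by rw [norm_stripMultiplierAt]; exact one_ne_zero)
    have h := hck
    rw [hcs, hct, ← hzs, ← hzt, hφ] at h
    exact mul_right_cancel₀ hne0 h
  by_cases hwin : ∃ j : Fin r, zs.re ∈ Ioo ((holeCentre r j).re + e j - w) ((holeCentre r j).re + e j + w)
  · obtain ⟨j, hj⟩ := hwin
    right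
    refine ⟨j, hj, hrad.symm, ?_⟩
    have hjs : |zs.re - (holeCentre r j).re - e j| < w := by
      rw [abs_lt]; constructor <;> linarith [hj.1, hj.2]
    have hjt : |zt.re - (holeCentre r j).re - e j| < w := by rw [← hrad]; exact hjs
    have hs0 : zs.im ≠ 0 :=
      im_ne_zero_of_re_mem_window (one_le_norm_zC_sub_holeCentre (hK.mem _).1 j) (he j) hjs
    have ht0 : zt.im ≠ 0 :=
      im_ne_zero_of_re_mem_window (one_le_norm_zC_sub_holeCentre (hK.mem _).1 j) (he j) hjt
    -- same signs would give an old crossing with value inside the window: excluded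
    have hnot : ¬ K₃.planeCurve s = K₃.planeCurve t := fun h ↦
      hcross s t h hne j (Ioo_subset_Icc_self hj)
    rcases hs0.lt_or_gt with hs_neg | hs_pos
    · rcases ht0.lt_or_gt with ht_neg | ht_pos
      · exfalso
        refine hnot (hold ?_)
        rw [stripMultiplierAt_eq_one hw fun i ↦ Or.inl hs_neg.le,
          stripMultiplierAt_eq_one hw fun i ↦ Or.inl ht_neg.le]
      · exact Or.inr ⟨hs_neg, ht_pos⟩
    · rcases ht0.lt_or_gt with ht_neg | ht_pos
      · exact Or.inl ⟨hs_pos, ht_neg⟩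
      · exfalso
        exact hnot (hold (stripMultiplierAt_eq_of_re_eq hrad hs_pos ht_pos k w e))
  · push Not at hwin
    left
    have hwin' : ∀ j : Fin r, zt.re ∉ Ioo ((holeCentre r j).re + e j - w) ((holeCentre r j).re + e j + w) := by
      intro j; rw [← hrad]; exact hwin j
    have hs' := planeCurve_twisted_eq_of_notMem_windows hK₃ hw hK₃k (s := s) hwin
    have ht' := planeCurve_twisted_eq_of_notMem_windows hK₃ hw hK₃k (s := t) hwin'
    have hold' : K₃.planeCurve s = K₃.planeCurve t := by rw [← hs', ← ht', hst]
    refine ⟨hold', fun j ↦ ⟨hcross s t hold' hne j, ?_⟩⟩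
    have := hcross s t hold' hne j
    rwa [hrad] at this

/-- **The equation of a new double point.**  If `s` is upper and `t` lower in the window of band
`j` and they have the same twisted plane-curve point, then
`c(s) · conj (stripUnit k w (z(s) - c_j - e_j)) = c(t)` for the complex planar coordinates
`c = chartC ∘ stereoCurve` of the ORIGINAL picture. [cite: ManolescuMarengonSarkarWillis2023, §8.1] -/
theorem chartC_eq_of_twisted_doublePoint {K : 𝕊 1 → 𝔼 4} {K₃ K₃k : Knot}
    (hK₃ : ⇑K₃ = finiteApprox r 0 K) {k : ℤ} {w : ℝ} (hw : 0 < w) {e : Fin r → ℝ}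
    (he : ∀ j, |e j| + w < 1) (hK₃k : ⇑K₃k = finiteApprox r 0 (stripTwistAt r k w e ∘ K))
    {s t : ℝ} (hst : K₃k.planeCurve s = K₃k.planeCurve t) {j : Fin r}
    (hj : (zC (K (circlePoint s))).re ∈ Ioo ((holeCentre r j).re + e j - w) ((holeCentre r j).re + e j + w))
    (ht : (zC (K (circlePoint t))).im < 0) :
    chartC (K₃.stereoCurve s) *
        conj (stripUnit k w (zC (K (circlePoint s)) - holeCentre r j - e j)) =
      chartC (K₃.stereoCurve t) := by
  have h1 : ∀ t, ‖stripMultiplierAt r k w e (zC (K t))‖ = 1 := fun t ↦ norm_stripMultiplierAt _ _ _ _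
  have hcs := chartC_stereoCurve_twisted (φ := stripMultiplierAt r k w e) hK₃ hK₃k h1 s
  have hct := chartC_stereoCurve_twisted (φ := stripMultiplierAt r k w e) hK₃ hK₃k h1 t
  have hck : chartC (K₃k.stereoCurve s) = chartC (K₃k.stereoCurve t) :=
    chartC_stereoCurve_eq_of_planeCurve_eq hst
  have hjs : |(zC (K (circlePoint s))).re - (holeCentre r j).re - e j| < w := by
    rw [abs_lt]; constructor <;> linarith [hj.1, hj.2]
  rw [hcs, hct, stripMultiplierAt_eq_stripUnit he hw hjs,
    stripMultiplierAt_eq_one hw fun i ↦ Or.inl ht.le, map_one, mul_one] at hck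
  exact hck

end MMSW

end Literature.Topology.FourManifolds

end
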